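import Summits.NavierStokesRegularity.NavierStokesRegularity.Theorems.StrainDoorsDirectionDoorK5Endpoint
import Summits.NavierStokesRegularity.NavierStokesRegularity.Theorems.StrainDoorsTypeIAncientCompactness
import Literature.Analysis.FluidPDE.TypeIAncientMildRescale
import Literature.Analysis.FluidPDE.LocalTypeIBlowup.SingularVertexZoom
import HarnessLib

/-!
# Strain doors, PART M §M21 — DOOR K5′ REDUCES TO (P1) + (P2): `K5FloorReduction` PROVED

ROUND 66 of the `ns-regularity-ideate` p1 line (helper lane of `stmt-NavierStokesRegularity-0056`, rung N0;
nothing here is a claim about Navier–Stokes regularity).  Lane line: «K5′ (a FIXED positive direction spread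
`δ(C₀,R,μ)` on every Type-I tangent peak) follows from the small-vorticity-number Liouville statement (P1) and the
sequential compactness (P2) of the Type-I ancient mild class — kernel-checked; (P1), (P2) remain the typed inputs».

ROUND 65 (`StrainDoorsDirectionDoorK5Endpoint`) typed door K5′ `PeakDirectionSpreadFloor C₀ R μ := ∃ δ > 0,
PeakDirectionSpreadRel C₀ δ R μ`, its two analytic inputs (P1) `SmallVorticityNumberLiouville`, (P2)
`TypeIAncientCompactness C`, and the target `K5FloorReduction : (P1) → (∀ C, (P2)) → ∀ C₀ R μ, 0 < R → 0 < μ →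
μ < 1 → PeakDirectionSpreadFloor C₀ R μ`.  This file PROVES `K5FloorReduction` (★★★ `k5FloorReduction_holds`):
if K5′ failed, `1/(j+1)`-coherent peaks `(v_j, z_j)` exist for every `j`; the recentred, time-shifted fields
`w_j(t,y) = v_j(t − 1/4, y + z_j)` lie in `A_{C₀}` (`IsTypeITangentPeak.isTypeIAncientMild_shift` + the space
translation covariance `isTypeIAncientMild_comp_add_right` of the class); by (P2) a subsequence converges, with its
curls, pointwise to some `W ∈ A_{C₀}`; the heights `ρ_j = |curl (w_j(−3/4)) 0| > η(C₀)` ((P1) via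
`peak_height_floor_of_smallVorticityNumberLiouville`) converge to `|e|`, `e := curl (W(−3/4)) 0 ≠ 0`; on the
OPEN set `U = B(0,R/2) ∩ {μ'|e| < |curl (W(−3/4))|}` (`μ < μ' < 1`, `0 ∈ U`) any point `y` is, for large `j`,
`μρ_j`-high for `w_j` together with `0`, at distance `< R`, so the directions of `curl (w_j(−3/4))` at `y` and `0`
differ by `≤ 1/(j+1)`; directions pass to the limit off the zero set, hence the direction of `curl (W(−3/4))` is
CONSTANT on `U`: `curl (W(−3/4)) ∥ e` on a non-empty open set at one time — and the one-slice Liouville theorem of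
ROUND 65 (`eq_zero_of_typeIAncientMild_of_curl_parallel_on_open`) forces `W ≡ 0`, contradicting `e ≠ 0`.

References: Giga–Miura, Comm. Math. Phys. 303 (2011) Prop. 2.2 and §3 (blow-up/compactness argument);
Barker–Prange, arXiv:1906.08225 §4; Koch–Nadirashvili–Seregin–Šverák, Acta Math. 203 (2009) Thm 5.1.
-/

noncomputable section

open MeasureTheory Set Function Filter Metric Real InnerProductSpace
open _root_.Topology
open scoped ENNReal NNReal RealInnerProductSpace ContDiff
open Literature.Analysis Literature.Analysis.FluidPDE
open Literature.Analysis.FluidPDE.VorticityDirectionDynamics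

-- the summit and its single sub-problem share the name (CONVENTIONS §1); option added at landing (ns-s30-p1 g6):
-- the text omits it and the gate bounces Lean warnings (`lint.warning`)
set_option linter.dupNamespace false

namespace Summit.NavierStokesRegularity.NavierStokesRegularity.Theorems.StrainDoors

/-! ### §M21(a) Translates -/

-- LANDING NOTE (ns-s30-p1 g6): the text's helper `curl_comp_add_right₆₆` (curl of a space translate) restates a landed,
-- importable declaration (gate `dedup.landed`, p715267: `…FluidComputer.BeltramiSextuplet.curl_translate`; the same
-- statement is also the S-lane's `StrainDoors.curl_comp_add_right_apply` of `StrainDoorsTypeIAncientCompactness`, p713178).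
-- The copy is deleted and its single use below cites `curl_comp_add_right_apply` (one extra import); every other
-- declaration is byte-identical to nsreg-p1 g37's r66 text (sha16 20dc69aa17744033).

/-- The normalisation map `b ↦ |b|⁻¹ b` is continuous off the origin. [folklore] -/
theorem continuousAt_inv_norm_smul {a : EuclideanSpace ℝ (Fin 3)} (ha : a ≠ 0) :
    ContinuousAt (fun b : EuclideanSpace ℝ (Fin 3) => ‖b‖⁻¹ • b) a :=
  ((continuous_norm.continuousAt).inv₀ (norm_ne_zero_iff.2 ha)).smul continuousAt_id

/-! ### §M21(b) The reduction -/

/-- ★★★ **DOOR K5′ ⇐ (P1) + (P2)** (`K5FloorReduction` of ROUND 65, PROVED): the small-vorticity-number Liouville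
statement and the sequential compactness of every class `A_C` imply, for all `C₀`, `R > 0`, `0 < μ < 1`, a positive
direction spread `δ(C₀,R,μ)` on every Type-I tangent peak (`PeakDirectionSpreadFloor C₀ R μ`), hence — by
`exists_pos_coherence_liouville_of_floor` — the fixed-`δ` direction criterion for classical Type-I ancient solutions.
Proof: compactness of `1/(j+1)`-coherent peaks (recentred, shifted into `A_{C₀}`) and the one-slice Liouville theorem
`eq_zero_of_typeIAncientMild_of_curl_parallel_on_open` at the limit, as in the module docstring.
[cite: GigaMiura2011, Prop. 2.2 and §3; BarkerPrange2020Alignment, §4 (arXiv:1906.08225)] -/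
theorem k5FloorReduction_holds : K5FloorReduction := by
  intro hP1 hP2 C₀ R μ hR hμ0 hμ1
  by_contra hF
  -- (0) negation of K5′: for every `δ > 0` a `δ`-coherent peak
  have hneg : ∀ δ : ℝ, 0 < δ →
      ∃ (v : ℝ → EuclideanSpace ℝ (Fin 3) → EuclideanSpace ℝ (Fin 3)) (z : EuclideanSpace ℝ (Fin 3)),
        IsTypeITangentPeak C₀ v z ∧
        ∀ y y' : EuclideanSpace ℝ (Fin 3), μ * ‖curl (v (-1)) z‖ < ‖curl (v (-1)) y‖ →
          μ * ‖curl (v (-1)) z‖ < ‖curl (v (-1)) y'‖ → ‖y' - y‖ ≤ R →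
            ‖vorticityDirection (curl (v (-1))) y' - vorticityDirection (curl (v (-1))) y‖ ≤ δ := by
    intro δ hδ
    by_contra h
    push Not at h
    exact hF ⟨δ, hδ, fun v z hP => h v z hP⟩
  choose v z hPk hcoh using fun j : ℕ => hneg (1 / ((j : ℝ) + 1)) (by positivity)
  -- (1) recentred, shifted fields `w_j(t,y) = v_j(t − 1/4, y + z_j)` in `A_{C₀}`
  obtain ⟨w, hw⟩ : ∃ w : ℕ → ℝ → EuclideanSpace ℝ (Fin 3) → EuclideanSpace ℝ (Fin 3),
      ∀ j t y, w j t y = v j (t - 1 / 4) (y + z j) := ⟨_, fun _ _ _ => rfl⟩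
  have hwA : ∀ j, IsTypeIAncientMild C₀ (w j) := by
    intro j
    have hwj : w j = fun t y => (fun t => v j (t - 1 / 4)) t (y + z j) :=
      funext fun t => funext fun y => hw j t y
    rw [hwj]
    exact (hPk j).isTypeIAncientMild_shift.comp_add_right (z j)
  have hslice : ∀ j, w j (-(3 / 4)) = fun y => v j (-1) (y + z j) := fun j => funext fun y => by
    rw [hw]; norm_num
  have hcurl : ∀ j y, curl (w j (-(3 / 4))) y = curl (v j (-1)) (y + z j) := fun j y => by
    rw [hslice, curl_comp_add_right_apply]
  have hcurl0 : ∀ j, curl (w j (-(3 / 4))) 0 = curl (v j (-1)) (z j) := fun j => by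
    rw [hcurl, zero_add]
  have hdir : ∀ j y, vorticityDirection (curl (w j (-(3 / 4)))) y =
      vorticityDirection (curl (v j (-1))) (y + z j) := fun j y => by
    simp only [vorticityDirection_apply, hcurl]
  have hdir0 : ∀ j, vorticityDirection (curl (w j (-(3 / 4)))) 0 =
      vorticityDirection (curl (v j (-1))) (z j) := fun j => by
    rw [hdir, zero_add]
  -- (2) compactness (P2) and the height floor (P1)
  obtain ⟨W, φ, hφ, hW, hlim⟩ := hP2 C₀ w hwA
  obtain ⟨η, hη, hfloor⟩ := peak_height_floor_of_smallVorticityNumberLiouville hP1 C₀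
  have h34 : (-(3 / 4) : ℝ) < 0 := by norm_num
  obtain ⟨e, he_def⟩ : ∃ e : EuclideanSpace ℝ (Fin 3), curl (W (-(3 / 4))) 0 = e := ⟨_, rfl⟩
  have hρ : Tendsto (fun j => ‖curl (v (φ j) (-1)) (z (φ j))‖) atTop (𝓝 ‖e‖) := by
    have h1 := ((hlim (-(3 / 4)) h34 0).2).norm
    rw [he_def] at h1
    refine h1.congr' (Eventually.of_forall fun j => ?_)
    rw [hcurl0]
  have hρpos : ∀ j, 0 < ‖curl (v j (-1)) (z j)‖ := fun j => hη.trans (hfloor _ _ (hPk j))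
  have hηe : η ≤ ‖e‖ := ge_of_tendsto hρ (Eventually.of_forall fun j => (hfloor _ _ (hPk (φ j))).le)
  have hepos : 0 < ‖e‖ := hη.trans_le hηe
  have he : e ≠ 0 := norm_pos_iff.1 hepos
  -- (3) the open high set of the limit slice
  obtain ⟨μ', hμμ', hμ'1⟩ : ∃ μ' : ℝ, μ < μ' ∧ μ' < 1 := ⟨(μ + 1) / 2, by linarith, by linarith⟩
  have hcW : Continuous (curl (W (-(3 / 4)))) := by
    have h2 : ContDiff ℝ 1 (W (-(3 / 4))) := (hW.contDiff_slice h34).of_le (by norm_cast)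
    exact (contDiff_curl (n := 0) (by exact_mod_cast h2)).continuous
  have hUo : IsOpen (ball (0 : EuclideanSpace ℝ (Fin 3)) (R / 2) ∩ {y | μ' * ‖e‖ < ‖curl (W (-(3 / 4))) y‖}) :=
    isOpen_ball.inter (isOpen_lt continuous_const hcW.norm)
  have h0U : (0 : EuclideanSpace ℝ (Fin 3)) ∈
      ball (0 : EuclideanSpace ℝ (Fin 3)) (R / 2) ∩ {y | μ' * ‖e‖ < ‖curl (W (-(3 / 4))) y‖} := by
    refine ⟨mem_ball_self (by linarith), ?_⟩
    show μ' * ‖e‖ < ‖curl (W (-(3 / 4))) 0‖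
    rw [he_def]; nlinarith
  -- (4) on `U` the direction of `curl (W(−3/4))` equals its direction at `0`
  have hT : ∀ y : EuclideanSpace ℝ (Fin 3), curl (W (-(3 / 4))) y ≠ 0 →
      Tendsto (fun j => vorticityDirection (curl (w (φ j) (-(3 / 4)))) y) atTop
        (𝓝 (vorticityDirection (curl (W (-(3 / 4)))) y)) := by
    intro y hy
    have h1 := (hlim (-(3 / 4)) h34 y).2
    have h2 := (continuousAt_inv_norm_smul hy).tendsto.comp h1
    simpa only [Function.comp_def, vorticityDirection_apply] using h2
  have hconst : ∀ y ∈ ball (0 : EuclideanSpace ℝ (Fin 3)) (R / 2) ∩ {y | μ' * ‖e‖ < ‖curl (W (-(3 / 4))) y‖},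
      vorticityDirection (curl (W (-(3 / 4)))) y = vorticityDirection (curl (W (-(3 / 4)))) 0 := by
    intro y hy
    have hyR : ‖y‖ < R / 2 := mem_ball_zero_iff.1 hy.1
    have hyhi : μ' * ‖e‖ < ‖curl (W (-(3 / 4))) y‖ := hy.2
    have hy0 : curl (W (-(3 / 4))) y ≠ 0 := by
      refine norm_pos_iff.1 (lt_of_le_of_lt ?_ hyhi); nlinarith
    have he0 : curl (W (-(3 / 4))) 0 ≠ 0 := by rw [he_def]; exact he
    -- eventually `y` and `0` are both `μρ_j`-high for `w_{φ j}`
    have hcy : Tendsto (fun j => ‖curl (w (φ j) (-(3 / 4))) y‖) atTop (𝓝 ‖curl (W (-(3 / 4))) y‖) :=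
      ((hlim (-(3 / 4)) h34 y).2).norm
    have hA : ∀ᶠ j in atTop, μ * ‖curl (v (φ j) (-1)) (z (φ j))‖ < ‖curl (w (φ j) (-(3 / 4))) y‖ :=
      (hρ.const_mul μ).eventually_lt hcy (by nlinarith)
    have hev : ∀ᶠ j in atTop,
        ‖vorticityDirection (curl (w (φ j) (-(3 / 4)))) y - vorticityDirection (curl (w (φ j) (-(3 / 4)))) 0‖ ≤
          1 / ((j : ℝ) + 1) := by
      filter_upwards [hA] with j hjA
      have hB : μ * ‖curl (v (φ j) (-1)) (z (φ j))‖ < ‖curl (v (φ j) (-1)) (z (φ j))‖ :=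
        mul_lt_of_lt_one_left (hρpos _) hμ1
      have hA' : μ * ‖curl (v (φ j) (-1)) (z (φ j))‖ < ‖curl (v (φ j) (-1)) (y + z (φ j))‖ := by
        rw [← hcurl]; exact hjA
      have hd : ‖y + z (φ j) - z (φ j)‖ ≤ R := by rw [add_sub_cancel_right]; linarith
      have key := hcoh (φ j) (z (φ j)) (y + z (φ j)) hB hA' hd
      rw [← hdir, ← hdir0] at key
      refine key.trans (one_div_le_one_div_of_le (by positivity) ?_)
      exact_mod_cast Nat.succ_le_succ (hφ.id_le j)
    have hle : ‖vorticityDirection (curl (W (-(3 / 4)))) y - vorticityDirection (curl (W (-(3 / 4)))) 0‖ ≤ 0 :=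
      le_of_tendsto_of_tendsto ((hT y hy0).sub (hT 0 he0)).norm
        (tendsto_one_div_add_atTop_nhds_zero_nat (𝕜 := ℝ)) hev
    exact sub_eq_zero.1 (norm_le_zero_iff.1 hle)
  -- (5) `curl (W(−3/4)) ∥ e` on `U`
  have hpar : ∀ y ∈ ball (0 : EuclideanSpace ℝ (Fin 3)) (R / 2) ∩ {y | μ' * ‖e‖ < ‖curl (W (-(3 / 4))) y‖},
      ∃ a : ℝ, curl (W (-(3 / 4))) y = a • e := by
    intro y hy
    have hyhi : μ' * ‖e‖ < ‖curl (W (-(3 / 4))) y‖ := hy.2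
    have hy0 : curl (W (-(3 / 4))) y ≠ 0 := by
      refine norm_pos_iff.1 (lt_of_le_of_lt ?_ hyhi); nlinarith
    have hξ := hconst y hy
    rw [vorticityDirection_apply, vorticityDirection_apply, he_def] at hξ
    refine ⟨‖curl (W (-(3 / 4))) y‖ * ‖e‖⁻¹, ?_⟩
    calc curl (W (-(3 / 4))) y
        = ‖curl (W (-(3 / 4))) y‖ • (‖curl (W (-(3 / 4))) y‖⁻¹ • curl (W (-(3 / 4))) y) := by
          rw [smul_smul, mul_inv_cancel₀ (norm_ne_zero_iff.2 hy0), one_smul]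
      _ = ‖curl (W (-(3 / 4))) y‖ • (‖e‖⁻¹ • e) := by rw [hξ]
      _ = (‖curl (W (-(3 / 4))) y‖ * ‖e‖⁻¹) • e := by rw [smul_smul]
  -- (6) the one-slice Liouville theorem: `W ≡ 0`, contradicting `e ≠ 0`
  have hzero := eq_zero_of_typeIAncientMild_of_curl_parallel_on_open hW h34 hUo ⟨0, h0U⟩ he hpar
  have hW0 : W (-(3 / 4)) = 0 := funext fun x => hzero _ h34 x
  exact he (by rw [← he_def, hW0]; exact curl_zero 0)

/-! ### §M21(c) Input (P2) is a theorem: sequential compactness of `A_C` with vorticities -/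

/-- ★★ **(P2) PROVED — sequential compactness of the Type-I ancient mild class, WITH CURLS**
(`TypeIAncientCompactness C` of ROUND 65): every sequence in `A_C` has a subsequence converging
pointwise on the open lower slab, together with its curls, to a member of `A_C`.  Fields: the
Type-I-rate form of KNSS 2009 Lemma 6.1 (`KNSS2009_lemma61_typeI_rate`: `C⁰_loc` extraction from
the uniform `1/4`-Hölder modulus, dominated convergence in the Oseen identity) and the packaging
`isTypeIAncientMild_of_continuous_oseenMild_rate` (KNSS Prop. 4.1 on time-shifted bounded copies);
curls: after the time shift `τ ↦ τ − (−t/2)` the sequence is BOUNDED by `C/√(−t/2)` up to time `0`,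
so the KNSS (4.10) window-uniform bounds and Landau interpolation (`tendsto_curl_of_bounded_oseenMild`)
give `curl u_{φ(j)}(t) → curl W(t)` pointwise.
[cite: KochNadirashviliSereginSverak2009, Lemma 6.1 (arXiv:0709.3599 p. 11) with Prop. 4.1 (4.10) p. 8; GigaMiura2011, §2.1 p. 6] -/
theorem typeIAncientCompactness_holds (C : ℝ) : TypeIAncientCompactness C := by
  intro u hu
  have hA : Tendsto (fun k : ℕ => -((k : ℝ) + 1)) atTop atBot :=
    tendsto_neg_atTop_atBot.comp (tendsto_atTop_add_const_right _ 1 tendsto_natCast_atTop_atTop)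
  have hrate : ∀ {v : ℝ → EuclideanSpace ℝ (Fin 3) → EuclideanSpace ℝ (Fin 3)}, IsTypeIAncientMild C v →
      ∀ τ : ℝ, τ < 0 → ∀ y, Real.sqrt (-τ) * ‖v τ y‖ ≤ C := by
    intro v hv τ hτ y
    have h := hv.norm_le hτ y
    rwa [le_div_iff₀ (Real.sqrt_pos.2 (neg_pos.2 hτ)), mul_comm] at h
  obtain ⟨φ, W, hφ, hWc, hWdiv, hWrate, hWmild, -, hpt, -⟩ :=
    KNSS2009_lemma61_typeI_rate (A := fun k : ℕ => -((k : ℝ) + 1)) (w := u) (C := C) hA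
      (fun k => (hu k).continuousOn_uncurry.mono (prod_mono Ioo_subset_Iio_self le_rfl))
      (fun k t ht => (hu k).isWeaklyDivFree ht.2)
      (fun k s t _ hst ht x => (hu k).mild_eq_heatExtension hst ht x)
      (fun k τ hτ x => hrate (hu k) τ hτ.2 x)
  have hWdec : HasTypeITimeDecay C W := fun t ht x => by
    rw [le_div_iff₀ (Real.sqrt_pos.2 (neg_pos.2 ht)), mul_comm]
    exact hWrate t ht x
  have hW : IsTypeIAncientMild C W :=
    LocalTypeIBlowup.isTypeIAncientMild_of_continuous_oseenMild_rate hWc hWdiv hWmild hWdec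
  refine ⟨W, φ, hφ, hW, fun t ht x => ⟨hpt t ht x, ?_⟩⟩
  -- curls at the slice `t`: shift by `δ = −t/2` into the bounded regime
  obtain ⟨δ, hδ0, hδt⟩ : ∃ δ : ℝ, 0 < δ ∧ -δ - δ = t := ⟨-t / 2, by linarith, by ring⟩
  have hsh : ∀ {v : ℝ → EuclideanSpace ℝ (Fin 3) → EuclideanSpace ℝ (Fin 3)}, IsTypeIAncientMild C v →
      IsTypeIAncientMild C (fun τ => v (τ - δ)) := fun hv => hv.comp_sub_right hδ0.le
  have hbdd : ∀ {v : ℝ → EuclideanSpace ℝ (Fin 3) → EuclideanSpace ℝ (Fin 3)}, IsTypeIAncientMild C v →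
      ∀ τ : ℝ, τ < 0 → ∀ y, ‖v (τ - δ) y‖ ≤ C / Real.sqrt δ := by
    intro v hv τ hτ y
    refine (hv.norm_le (by linarith) y).trans ?_
    exact div_le_div_of_nonneg_left hv.nonneg (Real.sqrt_pos.2 hδ0) (Real.sqrt_le_sqrt (by linarith))
  have key := tendsto_curl_of_bounded_oseenMild (A := fun k : ℕ => -((k : ℝ) + 1))
      (M := C / Real.sqrt δ) (w := fun k τ => u (φ k) (τ - δ)) (W := fun τ => W (τ - δ)) hA
      (fun k => (hsh (hu (φ k))).continuousOn_uncurry.mono (prod_mono Ioo_subset_Iio_self le_rfl))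
      (fun k τ hτ => (hsh (hu (φ k))).isWeaklyDivFree hτ.2)
      (fun k s τ _ hsτ hτ y => (hsh (hu (φ k))).mild_eq_heatExtension hsτ hτ y)
      (fun k τ hτ y => hbdd (hu (φ k)) τ hτ.2 y)
      (hsh hW).continuousOn_uncurry (fun τ hτ => (hsh hW).isWeaklyDivFree hτ)
      (fun s τ hsτ hτ y => (hsh hW).mild_eq_heatExtension hsτ hτ y) (fun τ hτ y => hbdd hW τ hτ y)
      (fun τ hτ y => hpt (τ - δ) (by linarith) y) (t := -δ) (by linarith) x
  simp only [hδt] at key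
  exact key

/-! ### §M21(d) Consequences conditional on (P1) alone -/

/-- ★★★ **DOOR K5′ ⇐ (P1)**: the small-vorticity-number Liouville statement ALONE implies a positive
direction spread `δ(C₀,R,μ) > 0` on every Type-I tangent peak, for all `C₀`, `R > 0`, `0 < μ < 1`
((P2) is the theorem `typeIAncientCompactness_holds`; (P1) is discharged by citation in the companion
file `StrainDoorsDirectionDoorK5Closed`). [cite: GigaMiura2011, Prop. 2.2 and §3; KochNadirashviliSereginSverak2009, Lemma 6.1] -/
theorem peakDirectionSpreadFloor_of_smallVorticityNumberLiouville (hP1 : SmallVorticityNumberLiouville)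
    (C₀ : ℝ) {R μ : ℝ} (hR : 0 < R) (hμ0 : 0 < μ) (hμ1 : μ < 1) : PeakDirectionSpreadFloor C₀ R μ :=
  k5FloorReduction_holds hP1 typeIAncientCompactness_holds C₀ R μ hR hμ0 hμ1

/-- ★★★ **THE FIXED-`δ` DIRECTION CRITERION ⇐ (P1)**. [cite: GigaMiura2011, Thm 1.1 (CA′); BarkerPrange2020Alignment, Thm. 3 (arXiv:1906.08225 §5.2)] -/
theorem exists_pos_coherence_liouville_of_smallVorticityNumberLiouville
    (hP1 : SmallVorticityNumberLiouville) (C₀ : ℝ) {R μ : ℝ} (hR : 0 < R) (hμ0 : 0 < μ) (hμ1 : μ < 1) :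
    ∃ δ : ℝ, 0 < δ ∧
      ∀ (u : ℝ → EuclideanSpace ℝ (Fin 3) → EuclideanSpace ℝ (Fin 3)) (p : ℝ → EuclideanSpace ℝ (Fin 3) → ℝ),
        IsClassicalNSSolutionOn (Iio 0) 1 0 u p → HasTypeIDecay C₀ u → RelParabolicDirectionCoherence δ R μ u →
        ∀ t : ℝ, t < 0 → ∀ x : EuclideanSpace ℝ (Fin 3), u t x = 0 :=
  exists_pos_coherence_liouville_of_floor hμ0.le
    (peakDirectionSpreadFloor_of_smallVorticityNumberLiouville hP1 C₀ hR hμ0 hμ1)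

end Summit.NavierStokesRegularity.NavierStokesRegularity.Theorems.StrainDoors

end
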